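import Summits.QuantumAdvantage.QuantumAdvantage.Statement
import Summits.QuantumAdvantage.QuantumAdvantage.Theorems.SoloBlindCeiling
import Literature.Computability.Cryptography.ShorAssemblyLeavesProofs
import Literature.Computability.Complexity.ExpClosure
import Literature.Computability.Complexity.UniformDerandomizationEndgame
import HarnessLib

/-!
# `QuantumAdvantage`: the weakest catalogued open consequence, `BPP ⊊ NEXP`

Third companion of `SoloBlindCeiling.lean` / `SoloBlindBridges.lean` (imports only the former). Arora–Barak
(*Computational Complexity*, 2009, §7.5, opening paragraph): "we suspect that `BPP` is
the same as `P` and hence (by the Time Hierarchy Theorem) `BPP` is a proper subset of, say,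
`DTIME(n^{log n})`. Yet currently researchers are not even able to show that `BPP` is a proper
subset of `NEXP`." This file records, sorry-free over the tree's discharged inclusions
`BPP ⊆ BQP ⊆ PP ⊆ PSPACE ⊆ EXP ⊆ NEXP`, that the summit settles that question and every strict
inclusion above `BPP` in the chain:

* `soloBlind_BPP_subset_NEXP : BPP ⊆ NEXP` (bookkeeping over the tree's `BPP_subset_EXP`, `EXP_subset_NEXP`);
* `soloBlind_not_NEXP_subset_BPP : QuantumAdvantage → ¬ NEXP ⊆ BPP`, `soloBlind_BPP_ne_NEXP`;
* strict forms `QuantumAdvantage → BPP ⊂ BQP`, `BPP ⊂ PP`, `BPP ⊂ PSPACE`, `BPP ⊂ EXP`,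
  `BPP ⊂ NEXP` — the last being the weakest statement in the chain, and still open
  (Arora–Barak 2009, §7.5; the unconditional state of the art separates `BPP` only from classes
  such as `MA_EXP` via circuit lower bounds, Buhrman–Fortnow–Thierauf 1998, and from
  `BPTIME(2^{n^ε})` via padding, Karpinski–Verbeek 1987 — neither of which is known to lie
  inside `NEXP`);
* `soloBlind_collapse_of_NEXP_subset_BPP`: contrapositive reading — in a world where
  `NEXP ⊆ BPP`, the summit is false and decision-factoring is in `BPP`.

Nothing here is progress towards the summit; it pins the bottom of the summit's ceiling chain to
the literature's named frontier.

References: S. Arora, B. Barak, *Computational Complexity: A Modern Approach* (2009), §7.5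
(opening paragraph) and §7.5.3; H. Buhrman, L. Fortnow, T. Thierauf, *Nonrelativizing separations*, CCC
1998, Thm. 3.4; M. Karpinski, R. Verbeek, *Randomness, provability, and the separation of Monte Carlo
time and space*, LNCS 270 (1987) 189–207, Thm. 2, as reported in E. Allender, R. Beigel,
U. Hertrampf, S. Homer, Theoret. Comput. Sci. 115 (1993), §1 and Cor. 3.4, in J.-Y. Cai, A. Nerurkar,
D. Sivakumar, STOC 1999, §1, and in Z. Lu, I. C. Oliveira, R. Santhanam, STOC 2021, §1.
-/

namespace Summit.QuantumAdvantage.QuantumAdvantage.Theorems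

open Literature.Computability.Complexity Literature.Computability.Complexity.Classes
  Literature.Computability.Complexity.Nondeterministic
  Literature.Computability.Cryptography Literature.Computability.QuantumComplexity

/-- `BPP ⊆ NEXP`, by the tree's `BPP_subset_EXP` (`BPP ⊆ Σ₂ᵖ ⊆ PH ⊆ EXP`) and `EXP ⊆ NEXP`
(Arora–Barak 2009, §2.6.2). -/
theorem soloBlind_BPP_subset_NEXP : BPP ⊆ NEXP :=
  BPP_subset_EXP.trans EXP_subset_NEXP

/-- **Summit ⇒ `NEXP ⊄ BPP`** — the summit decides the question Arora–Barak (2009, §7.5) single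
out as currently out of reach ("not even able to show that `BPP` is a proper subset of `NEXP`"). -/
theorem soloBlind_not_NEXP_subset_BPP (h : _root_.QuantumAdvantage) : ¬ (NEXP ⊆ BPP) :=
  fun hN => soloBlind_not_EXP_subset_BPP h (EXP_subset_NEXP.trans hN)

/-- Summit ⇒ `BPP ≠ NEXP`. -/
theorem soloBlind_BPP_ne_NEXP (h : _root_.QuantumAdvantage) : BPP ≠ NEXP := fun he =>
  soloBlind_not_NEXP_subset_BPP h he.ge

/-- Summit ⇒ `BPP ⊂ NEXP` (proper inclusion; the weakest link of the ceiling chain). -/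
theorem soloBlind_BPP_ssubset_NEXP (h : _root_.QuantumAdvantage) : BPP ⊂ NEXP :=
  Set.ssubset_iff_subset_ne.2 ⟨soloBlind_BPP_subset_NEXP, soloBlind_BPP_ne_NEXP h⟩

/-- Summit ⇒ `BPP ⊂ EXP` (Arora–Barak 2009, §7.5.2: "`BPP = EXP`?" is open). -/
theorem soloBlind_BPP_ssubset_EXP (h : _root_.QuantumAdvantage) : BPP ⊂ EXP :=
  Set.ssubset_iff_subset_ne.2 ⟨BPP_subset_EXP, soloBlind_BPP_ne_EXP h⟩

/-- Summit ⇒ `BPP ⊂ PSPACE`. -/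
theorem soloBlind_BPP_ssubset_PSPACE (h : _root_.QuantumAdvantage) : BPP ⊂ PSPACE :=
  Set.ssubset_iff_subset_ne.2
    ⟨fun _ hL => BQP_subset_PSPACE_holds (BPP_subset_BQP_holds hL), soloBlind_BPP_ne_PSPACE h⟩

/-- Summit ⇒ `BPP ⊂ PP`. -/
theorem soloBlind_BPP_ssubset_PP (h : _root_.QuantumAdvantage) : BPP ⊂ PP :=
  Set.ssubset_iff_subset_ne.2
    ⟨fun _ hL => BQP_subset_PP_holds (BPP_subset_BQP_holds hL), soloBlind_BPP_ne_PP h⟩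

/-- Summit ⇔ `BPP ⊂ BQP` (given the discharged `BPP ⊆ BQP`, the summit is exactly properness). -/
theorem soloBlind_iff_BPP_ssubset_BQP : _root_.QuantumAdvantage ↔ BPP ⊂ BQP := by
  rw [soloBlind_quantumAdvantage_iff_not_subset, Set.ssubset_iff_subset_ne]
  constructor
  · intro h
    exact ⟨BPP_subset_BQP_holds, fun he => h he.ge⟩
  · rintro ⟨-, hne⟩ hsub
    exact hne (Set.Subset.antisymm BPP_subset_BQP_holds hsub)

/-- **Contrapositive reading.** In a world where `NEXP ⊆ BPP` the summit fails, and then (Shor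
floor: the tree's proved `FACT_mem_BQP_holds`, cf. `soloBlind_of_FACT_not_mem_BPP` in
`SoloBlindBridges.lean`) decision-factoring is in `BPP` — of course directly too, since
`FACT ∈ NP ⊆ NEXP`; the point is the order of strength
`FACT ∉ BPP ⇒ Summit ⇒ EXP ⊄ BPP ⇒ NEXP ⊄ BPP`. -/
theorem soloBlind_collapse_of_NEXP_subset_BPP (hN : NEXP ⊆ BPP) :
    ¬ _root_.QuantumAdvantage ∧ FACT ∈ BPP :=
  have hq : ¬ _root_.QuantumAdvantage := fun h => soloBlind_not_NEXP_subset_BPP h hN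
  ⟨hq, by_contra fun hF => hq ⟨FACT, FACT_mem_BQP_holds, hF⟩⟩

end Summit.QuantumAdvantage.QuantumAdvantage.Theorems
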